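import Summits.AtomisticToContinuum.HydrodynamicLimit.Theorems.JParityClosureLocalSecondLawPassivityCollisionalOfEnskog
import Summits.AtomisticToContinuum.HydrodynamicLimit.Theorems.JParityClosureLocalSecondLawCollisionalWorkRegularity
import Summits.AtomisticToContinuum.HydrodynamicLimit.Theorems.JParityClosureLocalSecondLawKineticStressRegularity

/-!
# The integrability package of the P2 reduction holds
(stmt-AtomisticToContinuum-13081, line `exact-entropy-ledger-three-passivities`, stub P2)

`CollisionalWorkIntegrable` (`Theorems/JParityClosureLocalSecondLawPassivityCollisionalOfEnskog.lean`), the third —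
classical — input of the reduction `passivityCollisional_of_enskog`, is PROVED here
(`collisionalWorkIntegrable_holds`): on the regular event (`0 < r`, `0 < c`, `0 < σ`, EOS band with `η₁ < η₀`,
smooth `φ`) the space integrands `t2smoothI = (φ/θ_r) p_ex div u_r` and `t1weightedI = (φ/θ_r)(2/5)(Z−1)Σ^dev_r:∇u_r`
are Bochner integrable on `𝕋³` at every `s ∈ [0, τ]`, and their space integrals are integrable on `[0, τ]`.
Ingredients: the floors and the cap of `Regular`; `p_ex = ρ_rθ_r(Z(ρ_rσ³) − 1)` with `Z` continuous on the band and
`|Z − 1| ≤ η₁K` on `[cσ³, η₁]` (`Regular.abs_pexC_le`, `EosBand.continuousOn_hsCompressibility`); `ρ_rθ_r ≤ (2/3)e_r ≤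
(2/πr³) ke` and energy conservation along the good orbit; the strain `∂ₖu_{r,l}` is Borel in (configuration, point)
through the floored velocity and bounded by the strain constant (`psvK_measurable_pD_uFloor`, `psvK_abs_pD_uC_le` of
the kinetic-stress package); the orbit is Borel in time (`IsHardSphereTrajectory.measurable_torus`) and Fubini
measurability (`StronglyMeasurable.integral_prod_right'`) makes the space integral of the floored joint integrand a
bounded Borel function of `s`, equal to the true one on `[0, τ]`.  The weighted kinetic integrand is the `T₁`
integrand with the weight `φ ↦ φ·(2/5)(Z(ρ_rσ³)−1)` (Borel in `(s, x)`, bounded, continuous in `x` on the regular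
event), so the `T₁` lemmas `psvK_integrable_T₁_inner` / `psvK_integrableOn_T₁_outer` apply verbatim.
COROLLARIES: P2 follows from the two OPEN inputs alone (`passivityCollisional_of_enskog_weighted`), and the weighted
kinetic passivity (K) follows from P1's two inputs — kinetic `L¹`-isotropy at rate `r` and strain tightness at rate
`1/r`, the two hypotheses of `passivityKinetic_of_isotropy`, inlined verbatim — by the deterministic core
`psvK_abs_T₁_le` with the bounded weight `φ(2/5)(Z−1)` (`weightedKineticPassivity_of_isotropy`), whence
`passivityCollisional_of_enskog_isotropy : CollisionalWorkEnskogLaw → KineticIsotropyRate → StrainTightness → P2`.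

References: H. Spohn, *Large Scale Dynamics of Interacting Particles* (1991), Part I §3; H. van Beijeren,
M. H. Ernst, Physica 68 (1973) 437 (Enskog collisional transfer).
-/

noncomputable section

namespace Summit.AtomisticToContinuum.HydrodynamicLimit.Theorems.LocalSecondLawLedger

open scoped BigOperators Topology Classical MeasureTheory ENNReal InnerProductSpace
open Filter Set MeasureTheory
open Literature.MathematicalPhysics.KineticTheory
open Literature.Analysis.FluidPDE
open Summit.AtomisticToContinuum.HydrodynamicLimit.Theorems.LocalSecondLawNegative

variable {N : ℕ}

/-! ## Measurability and continuity of the compressibility factor along the coarse density -/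

/-- `Z(η) = 1 + η f_ex′(η)` is Borel (Mathlib: `deriv` of any function is measurable). -/
theorem cwI_measurable_hsCompressibility : Measurable hsCompressibility := by
  have h : hsCompressibility = fun η => 1 + η * deriv hsExcessFreeEnergy η := rfl
  rw [h]
  exact measurable_const.add (measurable_id.mul (measurable_deriv _))

/-- On the regular event inside the band, `x ↦ Z(ρ_r(Φₛz, x)σ³)` is continuous at every `s ∈ [0, τ]`. -/
theorem Regular.continuous_hsCompressibility {σ r τ c η₁ η₀ : ℝ} {F : ℝ → ℝ} {Φ : Flow σ N} {z : Phase N}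
    (hE : EosBand η₀ F) (h : Regular σ r τ c η₁ Φ z) (hσ : 0 < σ) (hc : 0 < c) (hη : η₁ < η₀) {s : ℝ}
    (hs : s ∈ Set.Icc (0 : ℝ) τ) :
    Continuous fun x => hsCompressibility (rhoC r (Φ.flow s z) x * σ ^ 3) :=
  hE.continuousOn_hsCompressibility.comp_continuous ((continuous_rhoC r _).mul continuous_const)
    fun x => h.rhoC_sigma_mem_Ioo hσ hc hη hs x

/-! ## The weighted kinetic integrand: the `T₁` lemmas with the weight `φ·(2/5)(Z−1)` -/

/-- `t1weightedI` is the `T₁` integrand with the weight `φ ↦ φ·(2/5)(Z(ρ_rσ³)−1)` (pointwise algebra). -/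
theorem t1weightedI_eq (σ r : ℝ) (φ : ℝ → T3 → ℝ) (Φ : Flow σ N) (z : Phase N) (s : ℝ) (x : T3) :
    t1weightedI σ r φ Φ z s x =
      φ s x * (2 / 5 * (hsCompressibility (rhoC r (Φ.flow s z) x * σ ^ 3) - 1)) / thetaC r (Φ.flow s z) x *
        ∑ k : Fin 3, ∑ l : Fin 3, devC r (Φ.flow s z) x k l * pD k (fun y => uC r (Φ.flow s z) y l) x := by
  unfold t1weightedI; ring

/-- **Inner integrability of the weighted kinetic integrand** on the regular event. -/
theorem integrable_t1weightedI {σ r τ c η₁ η₀ : ℝ} {F : ℝ → ℝ} {Φ : Flow σ N} {z : Phase N}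
    (hE : EosBand η₀ F) (h : Regular σ r τ c η₁ Φ z) (hr : 0 < r) (hσ : 0 < σ) (hc : 0 < c) (hη : η₁ < η₀)
    {φ : ℝ → T3 → ℝ} (hφ : Literature.Analysis.FunctionSpaces.Torus.IsSmoothSpaceTimeOn Set.univ φ)
    {s : ℝ} (hs : s ∈ Set.Icc (0 : ℝ) τ) : Integrable (t1weightedI σ r φ Φ z s) := by
  obtain ⟨-, hφc⟩ := psvK_measurable_of_isSmoothSpaceTimeOn hφ
  have hψ : Continuous fun x => φ s x * (2 / 5 * (hsCompressibility (rhoC r (Φ.flow s z) x * σ ^ 3) - 1)) :=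
    (hφc s).mul (continuous_const.mul ((h.continuous_hsCompressibility hE hσ hc hη hs).sub continuous_const))
  have hI := psvK_integrable_T₁_inner hr hc (fun y => h.rhoC_ge hs y) (fun y => h.thetaC_ge hs y) hψ
  refine hI.congr (Filter.Eventually.of_forall fun x => ?_)
  exact (t1weightedI_eq σ r φ Φ z s x).symm

/-- **Outer integrability of the weighted kinetic work** on the regular event. -/
theorem integrableOn_t1weightedI {σ r τ c η₁ η₀ : ℝ} {F : ℝ → ℝ} {Φ : Flow σ N} {z : Phase N}
    (hE : EosBand η₀ F) (h : Regular σ r τ c η₁ Φ z) (hr : 0 < r) (hσ : 0 < σ) (hc : 0 < c) (hη : η₁ < η₀)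
    {φ : ℝ → T3 → ℝ} (hφ : Literature.Analysis.FunctionSpaces.Torus.IsSmoothSpaceTimeOn Set.univ φ) :
    IntegrableOn (fun s => ∫ x : T3, t1weightedI σ r φ Φ z s x) (Set.Icc (0 : ℝ) τ) := by
  obtain ⟨hφm, -⟩ := psvK_measurable_of_isSmoothSpaceTimeOn hφ
  obtain ⟨Cφ, hCφ⟩ := hφ.exists_norm_le_of_isCompact isCompact_Icc (Set.subset_univ (Set.Icc (0 : ℝ) τ))
  obtain ⟨K, hK0, hK⟩ := hE.exists_bound (mul_pos hc (pow_pos hσ 3)) hη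
  have hγ : Measurable fun s => Φ.flow s z := IsHardSphereTrajectory.measurable_torus (Φ.isTrajectory z h.1)
  have hwx : Measurable fun q : ℝ × T3 => ((Φ.flow q.1 z, q.2) : Phase N × T3) :=
    (hγ.fun_comp measurable_fst).prodMk measurable_snd
  have hρm' := (continuous_rhoC_uncurry (N := N) r).measurable.fun_comp hwx
  have hρm : Measurable fun q : ℝ × T3 => rhoC r (Φ.flow q.1 z) q.2 := hρm'
  have hφ'm : Measurable (Function.uncurry fun s x =>
      φ s x * (2 / 5 * (hsCompressibility (rhoC r (Φ.flow s z) x * σ ^ 3) - 1))) :=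
    hφm.mul (measurable_const.mul ((cwI_measurable_hsCompressibility.fun_comp (hρm.mul_const _)).sub
      measurable_const))
  have hφ'b : ∀ s ∈ Set.Icc (0 : ℝ) τ, ∀ x,
      |φ s x * (2 / 5 * (hsCompressibility (rhoC r (Φ.flow s z) x * σ ^ 3) - 1))| ≤ Cφ * (2 / 5 * (η₁ * K)) := by
    intro s hs x
    rw [abs_mul]
    refine mul_le_mul ?_ ?_ (abs_nonneg _) ((norm_nonneg _).trans (hCφ s hs x))
    · rw [← Real.norm_eq_abs]; exact hCφ s hs x
    · rw [abs_mul, abs_of_pos (by norm_num : (0 : ℝ) < 2 / 5)]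
      exact mul_le_mul_of_nonneg_left (hK _ (h.rhoC_sigma_mem hσ hs x)).2 (by norm_num)
  have hI := psvK_integrableOn_T₁_outer hr hc h hφ'm hφ'b
  refine hI.congr_fun (fun s _ => ?_) measurableSet_Icc
  exact integral_congr_ae (Filter.Eventually.of_forall fun x => (t1weightedI_eq σ r φ Φ z s x).symm)

/-! ## The excess-pressure integrand -/

/-- Pointwise bound of the excess-pressure work integrand on the regular event: with `|φ(s,·)| ≤ Cφ`,
`|p_ex| ≤ ρ_rθ_r η₁K`, `ρ_rθ_r ≤ (2/πr³)ke`, `|∂ₖu_{r,k}| ≤ Kₛ(r, c, ke)` and `θ_r ≥ c`: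
`|t2smoothI| ≤ (Cφ/c) · (2/πr³)ke(z)·η₁K · 3Kₛ`. -/
theorem abs_t2smoothI_le {σ r τ c η₁ : ℝ} (hr : 0 < r) (hc : 0 < c) {Φ : Flow σ N} {z : Phase N}
    (h : Regular σ r τ c η₁ Φ z) {s : ℝ} (hs : s ∈ Set.Icc (0 : ℝ) τ) {φ : ℝ → T3 → ℝ} {Cφ K : ℝ}
    (hφb : ∀ x, |φ s x| ≤ Cφ) (hK0 : 0 ≤ η₁ * K)
    (hK : ∀ x, |pexC σ r (Φ.flow s z) x| ≤ rhoC r (Φ.flow s z) x * thetaC r (Φ.flow s z) x * (η₁ * K))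
    (x : T3) :
    |t2smoothI σ r φ Φ z s x| ≤ Cφ / c * (2 / 3 * (3 / (Real.pi * r ^ 3) * ke z) * (η₁ * K)) *
      (3 * (3 / (Real.pi * r ^ 4) * (1 / 2 + ke z) / c +
        3 / (Real.pi * r ^ 3) * (1 / 2 + ke z) * (3 / (Real.pi * r ^ 4)) / c ^ 2)) := by
  have hfl : ∀ y, c ≤ rhoC r (Φ.flow s z) y := fun y => h.rhoC_ge hs y
  have hθ : c ≤ thetaC r (Φ.flow s z) x := h.thetaC_ge hs x
  have hθpos : 0 < thetaC r (Φ.flow s z) x := hc.trans_le hθ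
  have hCφ : 0 ≤ Cφ := (abs_nonneg _).trans (hφb x)
  have hke : ke (Φ.flow s z) = ke z := ke_flow_eq Φ h.1 s
  have h1 : |φ s x / thetaC r (Φ.flow s z) x| ≤ Cφ / c := by
    rw [abs_div, abs_of_pos hθpos]; exact div_le_div₀ hCφ (hφb x) hc hθ
  have h2 : |pexC σ r (Φ.flow s z) x| ≤ 2 / 3 * (3 / (Real.pi * r ^ 3) * ke z) * (η₁ * K) := by
    refine (hK x).trans (mul_le_mul_of_nonneg_right ?_ hK0)
    rw [← hke]
    have hA := psvK_rhoC_mul_thetaC_le hr (Φ.flow s z) x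
    have hB := psvK_kinC_le hr (Φ.flow s z) x
    linarith
  have h3 : |∑ k : Fin 3, pD k (fun y => uC r (Φ.flow s z) y k) x| ≤
      3 * (3 / (Real.pi * r ^ 4) * (1 / 2 + ke z) / c +
        3 / (Real.pi * r ^ 3) * (1 / 2 + ke z) * (3 / (Real.pi * r ^ 4)) / c ^ 2) := by
    rw [← hke]
    calc _ ≤ ∑ k : Fin 3, |pD k (fun y => uC r (Φ.flow s z) y k) x| := Finset.abs_sum_le_sum_abs _ _
      _ ≤ ∑ _k : Fin 3, (3 / (Real.pi * r ^ 4) * (1 / 2 + ke (Φ.flow s z)) / c +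
            3 / (Real.pi * r ^ 3) * (1 / 2 + ke (Φ.flow s z)) * (3 / (Real.pi * r ^ 4)) / c ^ 2) :=
          Finset.sum_le_sum fun k _ => psvK_abs_pD_uC_le hr hc hfl x k k
      _ = _ := by simp only [Finset.sum_const, Finset.card_univ, Fintype.card_fin, nsmul_eq_mul, Nat.cast_ofNat]
  have h12 : 0 ≤ Cφ / c * (2 / 3 * (3 / (Real.pi * r ^ 3) * ke z) * (η₁ * K)) :=
    mul_nonneg (div_nonneg hCφ hc.le) (mul_nonneg (mul_nonneg (by norm_num)
      (mul_nonneg (by positivity) (ke_nonneg z))) hK0)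
  unfold t2smoothI
  rw [abs_mul, abs_mul]
  exact mul_le_mul (mul_le_mul h1 h2 (abs_nonneg _) (div_nonneg hCφ hc.le)) h3 (abs_nonneg _) h12

/-- **Inner integrability of the excess-pressure work integrand** on the regular event. -/
theorem integrable_t2smoothI {σ r τ c η₁ η₀ : ℝ} {F : ℝ → ℝ} {Φ : Flow σ N} {z : Phase N}
    (hE : EosBand η₀ F) (h : Regular σ r τ c η₁ Φ z) (hr : 0 < r) (hσ : 0 < σ) (hc : 0 < c) (hη : η₁ < η₀)
    {φ : ℝ → T3 → ℝ} (hφ : Literature.Analysis.FunctionSpaces.Torus.IsSmoothSpaceTimeOn Set.univ φ)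
    {s : ℝ} (hs : s ∈ Set.Icc (0 : ℝ) τ) : Integrable (t2smoothI σ r φ Φ z s) := by
  obtain ⟨-, hφc⟩ := psvK_measurable_of_isSmoothSpaceTimeOn hφ
  obtain ⟨K, hK0, hK⟩ := h.abs_pexC_le hE hσ hc hη
  have hfl : ∀ y, c ≤ rhoC r (Φ.flow s z) y := fun y => h.rhoC_ge hs y
  -- measurability
  have hmθ := (psvK_measurable_thetaC_uncurry (N := N) r).fun_comp (measurable_prodMk_left (x := Φ.flow s z))
  have hmρ : Measurable fun x => rhoC r (Φ.flow s z) x := (continuous_rhoC r _).measurable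
  have hmpex : Measurable fun x => pexC σ r (Φ.flow s z) x := by
    have h' : (fun x => pexC σ r (Φ.flow s z) x) = fun x => rhoC r (Φ.flow s z) x * thetaC r (Φ.flow s z) x *
        (hsCompressibility (rhoC r (Φ.flow s z) x * σ ^ 3) - 1) := by
      funext x; exact pexC_eq_compressibility σ r _ x
    rw [h']
    exact (hmρ.mul hmθ).mul ((cwI_measurable_hsCompressibility.fun_comp (hmρ.mul_const _)).sub measurable_const)
  have hmpD' := fun k l =>
    (psvK_measurable_pD_uFloor (N := N) hc r k l).fun_comp (measurable_prodMk_left (x := Φ.flow s z))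
  have hmpD : ∀ k, Measurable fun x => pD k (fun y => uC r (Φ.flow s z) y k) x := by
    intro k
    rw [← psvK_uFloor_eq_uC hfl k]
    exact hmpD' k k
  have hmeas : Measurable (t2smoothI σ r φ Φ z s) := by
    have h' : t2smoothI σ r φ Φ z s = fun x => φ s x / thetaC r (Φ.flow s z) x * pexC σ r (Φ.flow s z) x *
        ∑ k : Fin 3, pD k (fun y => uC r (Φ.flow s z) y k) x := by funext x; rfl
    rw [h']
    exact (((hφc s).measurable.div hmθ).mul hmpex).mul (Finset.measurable_sum _ fun k _ => hmpD k)
  -- bound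
  obtain ⟨Cφ, hCφ⟩ := isCompact_univ.exists_bound_of_continuousOn (hφc s).continuousOn
  have hφb : ∀ x, |φ s x| ≤ Cφ := fun x => by rw [← Real.norm_eq_abs]; exact hCφ x (Set.mem_univ x)
  have hη₁K : 0 ≤ η₁ * K := by
    have hm := h.rhoC_sigma_mem hσ hs (Classical.arbitrary T3)
    exact mul_nonneg ((mul_pos hc (pow_pos hσ 3)).le.trans (hm.1.trans hm.2)) hK0
  have hbd : ∀ x, ‖t2smoothI σ r φ Φ z s x‖ ≤ Cφ / c * (2 / 3 * (3 / (Real.pi * r ^ 3) * ke z) * (η₁ * K)) *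
      (3 * (3 / (Real.pi * r ^ 4) * (1 / 2 + ke z) / c +
        3 / (Real.pi * r ^ 3) * (1 / 2 + ke z) * (3 / (Real.pi * r ^ 4)) / c ^ 2)) := fun x => by
    rw [Real.norm_eq_abs]
    exact abs_t2smoothI_le hr hc h hs hφb hη₁K (hK s hs) x
  exact Integrable.mono' (integrable_const _) hmeas.aestronglyMeasurable (Filter.Eventually.of_forall hbd)

/-- **Outer integrability of the excess-pressure work** on the regular event (Fubini measurability of the floored
joint integrand along the Borel orbit; bounded by energy conservation). -/
theorem integrableOn_t2smoothI {σ r τ c η₁ η₀ : ℝ} {F : ℝ → ℝ} {Φ : Flow σ N} {z : Phase N}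
    (hE : EosBand η₀ F) (h : Regular σ r τ c η₁ Φ z) (hr : 0 < r) (hσ : 0 < σ) (hc : 0 < c) (hη : η₁ < η₀)
    {φ : ℝ → T3 → ℝ} (hφ : Literature.Analysis.FunctionSpaces.Torus.IsSmoothSpaceTimeOn Set.univ φ) :
    IntegrableOn (fun s => ∫ x : T3, t2smoothI σ r φ Φ z s x) (Set.Icc (0 : ℝ) τ) := by
  obtain ⟨hφm, -⟩ := psvK_measurable_of_isSmoothSpaceTimeOn hφ
  obtain ⟨Cφ, hCφ⟩ := hφ.exists_norm_le_of_isCompact isCompact_Icc (Set.subset_univ (Set.Icc (0 : ℝ) τ))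
  obtain ⟨K, hK0, hK⟩ := h.abs_pexC_le hE hσ hc hη
  have hγ : Measurable fun s => Φ.flow s z := IsHardSphereTrajectory.measurable_torus (Φ.isTrajectory z h.1)
  have hwx : Measurable fun q : ℝ × T3 => ((Φ.flow q.1 z, q.2) : Phase N × T3) :=
    (hγ.fun_comp measurable_fst).prodMk measurable_snd
  -- the floored joint integrand
  have hθm := (psvK_measurable_thetaC_uncurry (N := N) r).fun_comp hwx
  have hρm' := (continuous_rhoC_uncurry (N := N) r).measurable.fun_comp hwx
  have hρm : Measurable fun q : ℝ × T3 => rhoC r (Φ.flow q.1 z) q.2 := hρm'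
  have hpexm : Measurable fun q : ℝ × T3 => pexC σ r (Φ.flow q.1 z) q.2 := by
    have h' : (fun q : ℝ × T3 => pexC σ r (Φ.flow q.1 z) q.2) = fun q =>
        rhoC r (Φ.flow q.1 z) q.2 * thetaC r (Φ.flow q.1 z) q.2 *
          (hsCompressibility (rhoC r (Φ.flow q.1 z) q.2 * σ ^ 3) - 1) := by
      funext q; exact pexC_eq_compressibility σ r _ _
    rw [h']
    exact (hρm.mul hθm).mul ((cwI_measurable_hsCompressibility.fun_comp (hρm.mul_const _)).sub measurable_const)
  have hpDm := fun k l => (psvK_measurable_pD_uFloor (N := N) hc r k l).fun_comp hwx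
  have hFm : Measurable fun q : ℝ × T3 => φ q.1 q.2 / thetaC r (Φ.flow q.1 z) q.2 * pexC σ r (Φ.flow q.1 z) q.2 *
      ∑ k : Fin 3, pD k (fun y => (max (rhoC r (Φ.flow q.1 z) y) c)⁻¹ * momC r (Φ.flow q.1 z) y k) q.2 :=
    ((hφm.div hθm).mul hpexm).mul (Finset.measurable_sum _ fun k _ => hpDm k k)
  have hGm : StronglyMeasurable fun s => ∫ x : T3, φ s x / thetaC r (Φ.flow s z) x * pexC σ r (Φ.flow s z) x *
      ∑ k : Fin 3, pD k (fun y => (max (rhoC r (Φ.flow s z) y) c)⁻¹ * momC r (Φ.flow s z) y k) x :=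
    hFm.stronglyMeasurable.integral_prod_right'
  -- on `[0, τ]` it is the time integrand of `T₂smooth`
  have hEq : Set.EqOn (fun s => ∫ x : T3, φ s x / thetaC r (Φ.flow s z) x * pexC σ r (Φ.flow s z) x *
      ∑ k : Fin 3, pD k (fun y => (max (rhoC r (Φ.flow s z) y) c)⁻¹ * momC r (Φ.flow s z) y k) x)
      (fun s => ∫ x : T3, t2smoothI σ r φ Φ z s x) (Set.Icc (0 : ℝ) τ) := by
    intro s hs
    have hfl : ∀ y, c ≤ rhoC r (Φ.flow s z) y := fun y => h.rhoC_ge hs y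
    simp only [t2smoothI, psvK_uFloor_eq_uC hfl]
  -- bound on `[0, τ]`
  have hbound : ∀ s ∈ Set.Icc (0 : ℝ) τ, ‖∫ x : T3, φ s x / thetaC r (Φ.flow s z) x * pexC σ r (Φ.flow s z) x *
      ∑ k : Fin 3, pD k (fun y => (max (rhoC r (Φ.flow s z) y) c)⁻¹ * momC r (Φ.flow s z) y k) x‖ ≤
      Cφ / c * (2 / 3 * (3 / (Real.pi * r ^ 3) * ke z) * (η₁ * K)) *
        (3 * (3 / (Real.pi * r ^ 4) * (1 / 2 + ke z) / c +
          3 / (Real.pi * r ^ 3) * (1 / 2 + ke z) * (3 / (Real.pi * r ^ 4)) / c ^ 2)) := by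
    intro s hs
    have hfl : ∀ y, c ≤ rhoC r (Φ.flow s z) y := fun y => h.rhoC_ge hs y
    have hφb : ∀ x, |φ s x| ≤ Cφ := fun x => by rw [← Real.norm_eq_abs]; exact hCφ s hs x
    have hη₁K : 0 ≤ η₁ * K := by
      have hm := h.rhoC_sigma_mem hσ hs (Classical.arbitrary T3)
      exact mul_nonneg ((mul_pos hc (pow_pos hσ 3)).le.trans (hm.1.trans hm.2)) hK0
    simp only [psvK_uFloor_eq_uC hfl]
    refine (norm_integral_le_of_norm_le_const
      (C := Cφ / c * (2 / 3 * (3 / (Real.pi * r ^ 3) * ke z) * (η₁ * K)) *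
        (3 * (3 / (Real.pi * r ^ 4) * (1 / 2 + ke z) / c +
          3 / (Real.pi * r ^ 3) * (1 / 2 + ke z) * (3 / (Real.pi * r ^ 4)) / c ^ 2)))
      (Filter.Eventually.of_forall fun x => ?_)).trans ?_
    · rw [Real.norm_eq_abs]
      exact abs_t2smoothI_le hr hc h hs hφb hη₁K (hK s hs) x
    · simp
  have hInt : IntegrableOn (fun s => ∫ x : T3, φ s x / thetaC r (Φ.flow s z) x * pexC σ r (Φ.flow s z) x *
      ∑ k : Fin 3, pD k (fun y => (max (rhoC r (Φ.flow s z) y) c)⁻¹ * momC r (Φ.flow s z) y k) x)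
      (Set.Icc (0 : ℝ) τ) :=
    Measure.integrableOn_of_bounded measure_Icc_lt_top.ne hGm.aestronglyMeasurable
      ((ae_restrict_iff' measurableSet_Icc).2 (Filter.Eventually.of_forall hbound))
  exact hInt.congr_fun hEq measurableSet_Icc

/-! ## The package and the two-input reduction (registered; signatures verbatim) -/

/-- **`CollisionalWorkIntegrable` holds** (registered `collisionalWorkIntegrable_holds`): the integrability input
of the P2 reduction is a theorem. -/
theorem collisionalWorkIntegrable_holds :
  CollisionalWorkIntegrable := by
  intro η₀ F hE η₁ c σ r τ hη hc hσ hr _hτ φ hφ N Φ z hz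
  exact ⟨fun s hs => ⟨integrable_t2smoothI hE hz hr hσ hc hη hφ hs, integrable_t1weightedI hE hz hr hσ hc hη hφ hs⟩,
    integrableOn_t2smoothI hE hz hr hσ hc hη hφ, integrableOn_t1weightedI hE hz hr hσ hc hη hφ⟩

/-- **P2 from the two open inputs** (registered `passivityCollisional_of_enskog_weighted`;
`passivityCollisional_of_enskog` with its classical third input discharged): an EvenStressEnskog law for the
strain-weighted marks (W) and the `(Z−1)`-weighted kinetic passivity (K) imply the registered stub
`stub_passivityCollisional`'s statement verbatim. -/
theorem passivityCollisional_of_enskog_weighted :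
  CollisionalWorkEnskogLaw → WeightedKineticPassivity → ∀ (η₀ : ℝ) (F : ℝ → ℝ), EosBand η₀ F → ∀ η₁ : ℝ, 0 < η₁ → η₁ < η₀ → ∀ (a₀ θ₀ : T3 → ℝ) (u₀ : T3 → V3), Continuous a₀ → Continuous θ₀ → Continuous u₀ → (∀ x, 0 < a₀ x) → (∀ x, 0 < θ₀ x) → ∃ σ₀ : ℝ, 0 < σ₀ ∧ ∀ σ : ℝ, 0 < σ → σ < σ₀ → ∀ (T : ℝ) (ρ θ : ℝ → T3 → ℝ) (u : ℝ → T3 → V3), IsHardSphereEulerSolution σ T ρ u θ → ∀ Φ : (N : ℕ) → Flow σ N, TendstoHydroFieldsAt (fun N => localGibbsLaw σ a₀ u₀ θ₀ N (Φ N)) Φ ρ u θ 0 → 0 < T → ∀ τ : ℝ, 0 < τ → ∀ φ : ℝ → T3 → ℝ, Literature.Analysis.FunctionSpaces.Torus.IsSmoothSpaceTimeOn Set.univ φ → (∀ s x, 0 ≤ φ s x) → (∃ τ' : ℝ, τ' < τ ∧ ∀ s, τ' ≤ s → ∀ x, φ s x = 0) → ∀ c : ℝ, 0 < c → ∀ η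 δ : ℝ, 0 < η → 0 < δ → ∃ r₀ : ℝ, 0 < r₀ ∧ ∀ r : ℝ, 0 < r → r < r₀ → ∃ N₀ : ℕ, ∀ N : ℕ, N₀ ≤ N → localGibbsLaw σ a₀ u₀ θ₀ N (Φ N) {z | Regular σ r τ c η₁ (Φ N) z ∧ T₂ σ r τ φ (Φ N) z < -η} ≤ ENNReal.ofReal δ :=
  fun hW hK => passivityCollisional_of_enskog hW hK collisionalWorkIntegrable_holds

/-! ## The weighted kinetic passivity from P1's inputs -/

/-- `T₁weighted` is `T₁` with the (configuration-dependent) weight `φ·(2/5)(Z(ρ_rσ³)−1)` (pointwise algebra under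
the integral signs; no integrability needed). -/
theorem T₁weighted_eq_T₁ (σ r τ : ℝ) (φ : ℝ → T3 → ℝ) (Φ : Flow σ N) (z : Phase N) :
    T₁weighted σ r τ φ Φ z =
      T₁ σ r τ (fun s x => φ s x * (2 / 5 * (hsCompressibility (rhoC r (Φ.flow s z) x * σ ^ 3) - 1))) Φ z := by
  simp only [T₁weighted, T₁, t1weightedI_eq]

/-- **(K) from P1's inputs** (registered `weightedKineticPassivity_of_isotropy`): kinetic `L¹`-isotropy at rate `r`
and strain tightness at rate `1/r` (the two hypotheses of `passivityKinetic_of_isotropy`,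
`Theorems/JParityClosureLocalSecondLawPassivityKineticOfIsotropy.lean`, inlined verbatim) imply the
`(Z−1)`-weighted kinetic passivity, by the deterministic core `psvK_abs_T₁_le` applied to the bounded weight
`φ·(2/5)(Z−1)` (`|Z − 1| ≤ η₁K_Z` on the band): with `M ≥ sup|φ|(2/5)η₁K_Z`, `K` from strain tightness at `δ/2` and
isotropy at level `ηc/((M+1)K)`, `δ/2`, the core gives `|T₁weighted| ≤ (MK/(cr))(ηc/((M+1)K))r < η` off the two
exceptional events; union bound. -/
theorem weightedKineticPassivity_of_isotropy :
  (∀ (a₀ θ₀ : T3 → ℝ) (u₀ : T3 → V3), Continuous a₀ → Continuous θ₀ → Continuous u₀ → (∀ x, 0 < a₀ x) → (∀ x, 0 < θ₀ x) → ∃ σ₀ : ℝ, 0 < σ₀ ∧ ∀ σ : ℝ, 0 < σ → σ < σ₀ → ∀ (T : ℝ) (ρ θ : ℝ → T3 → ℝ) (u : ℝ → T3 → V3), IsHardSphereEulerSolution σ T ρ u θ → ∀ Φ : (N : ℕ) → Flow σ N, TendstoHydroFieldsAt (fun N => localGibbsLaw σ a₀ u₀ θ₀ N (Φ N)) Φ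 ρ u θ 0 → 0 < T → ∀ τ : ℝ, 0 < τ → ∀ c η₁ : ℝ, 0 < c → ∀ η δ : ℝ, 0 < η → 0 < δ → ∃ r₀ : ℝ, 0 < r₀ ∧ ∀ r : ℝ, 0 < r → r < r₀ → ∃ N₀ : ℕ, ∀ N : ℕ, N₀ ≤ N → localGibbsLaw σ a₀ u₀ θ₀ N (Φ N) {z | Regular σ r τ c η₁ (Φ N) z ∧ η * r < ∫ s in Set.Icc (0 : ℝ) τ, ∫ x : T3, ∑ k : Fin 3, ∑ l : Fin 3, |devC r ((Φ N).flow s z) x k l|} ≤ ENNReal.ofReal δ) → (∀ (a₀ θ₀ : T3 → ℝ) (u₀ : T3 → V3), Continuous a₀ → Continuous θ₀ → Continuous u₀ → (∀ x, 0 < a₀ x) → (∀ x, 0 < θ₀ x) → ∃ σ₀ : ℝ, 0 < σ₀ ∧ ∀ σ : ℝ, 0 < σ → σ < σ₀ → ∀ (T : ℝ) (ρ θ : ℝ → T3 → ℝ) (u : ℝ → T3 → V3), IsHardSphereEulerSolution σ T ρ u θ → ∀ Φ : (N : ℕ) → Flow σ N, TendstoHydroFieldsAt (fun N => localGibbsLaw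 σ a₀ u₀ θ₀ N (Φ N)) Φ ρ u θ 0 → 0 < T → ∀ τ : ℝ, 0 < τ → ∀ c η₁ : ℝ, 0 < c → ∀ δ : ℝ, 0 < δ → ∃ K : ℝ, 0 < K ∧ ∃ r₀ : ℝ, 0 < r₀ ∧ ∀ r : ℝ, 0 < r → r < r₀ → ∃ N₀ : ℕ, ∀ N : ℕ, N₀ ≤ N → localGibbsLaw σ a₀ u₀ θ₀ N (Φ N) {z | Regular σ r τ c η₁ (Φ N) z ∧ ∃ s ∈ Set.Icc (0 : ℝ) τ, ∃ x : T3, ∃ k l : Fin 3, K < r * |pD k (fun y => uC r ((Φ N).flow s z) y l) x|} ≤ ENNReal.ofReal δ) → WeightedKineticPassivity := by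
  intro hIso hStr η₀ F hEos η₁ hη₁ hη₁lt a₀ θ₀ u₀ ha hθ hu ha0 hθ0
  obtain ⟨σ₁, hσ₁, H1⟩ := hIso a₀ θ₀ u₀ ha hθ hu ha0 hθ0
  obtain ⟨σ₂, hσ₂, H2⟩ := hStr a₀ θ₀ u₀ ha hθ hu ha0 hθ0
  refine ⟨min σ₁ σ₂, lt_min hσ₁ hσ₂, ?_⟩
  intro σ hσ hσlt T ρ θ u hE Φ h0 hT τ hτ φ hφ _hφ0 _hsupp c hc η δ hη hδ
  have hσ1 : σ < σ₁ := lt_of_lt_of_le hσlt (min_le_left _ _)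
  have hσ2 : σ < σ₂ := lt_of_lt_of_le hσlt (min_le_right _ _)
  have hδ2 : 0 < δ / 2 := by positivity
  -- the weight bound on `[0,τ] × 𝕋³`: `|φ (2/5)(Z−1)| ≤ M₀ (2/5) η₁ K_Z ≤ M`
  obtain ⟨M₀, hM₀⟩ := hφ.exists_norm_le_of_isCompact isCompact_Icc (Set.subset_univ (Set.Icc (0 : ℝ) τ))
  obtain ⟨KZ, hKZ0, hKZ⟩ := hEos.exists_bound (mul_pos hc (pow_pos hσ 3)) hη₁lt
  set M : ℝ := max (M₀ * (2 / 5 * (η₁ * KZ))) 0 with hMdef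
  have hM0 : 0 ≤ M := le_max_right _ _
  -- strain tightness at `δ/2`, isotropy at level `η c / ((M + 1) K)`, `δ/2`
  obtain ⟨K, hK, r₂, hr₂, H2'⟩ := H2 σ hσ hσ2 T ρ θ u hE Φ h0 hT τ hτ c η₁ hc (δ / 2) hδ2
  have hη' : 0 < η * c / ((M + 1) * K) := by positivity
  obtain ⟨r₁, hr₁, H1'⟩ :=
    H1 σ hσ hσ1 T ρ θ u hE Φ h0 hT τ hτ c η₁ hc (η * c / ((M + 1) * K)) (δ / 2) hη' hδ2
  refine ⟨min r₁ r₂, lt_min hr₁ hr₂, ?_⟩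
  intro r hr hrlt
  obtain ⟨N₁, HN1⟩ := H1' r hr (lt_of_lt_of_le hrlt (min_le_left _ _))
  obtain ⟨N₂, HN2⟩ := H2' r hr (lt_of_lt_of_le hrlt (min_le_right _ _))
  refine ⟨max N₁ N₂, fun N hN => ?_⟩
  have E1 := HN1 N ((le_max_left _ _).trans hN)
  have E2 := HN2 N ((le_max_right _ _).trans hN)
  -- the weight bound on the regular event
  have hM : ∀ z : Phase N, Regular σ r τ c η₁ (Φ N) z → ∀ s ∈ Set.Icc (0 : ℝ) τ, ∀ x,
      |φ s x * (2 / 5 * (hsCompressibility (rhoC r ((Φ N).flow s z) x * σ ^ 3) - 1))| ≤ M := by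
    intro z hz s hs x
    refine le_trans ?_ (le_max_left _ _)
    rw [abs_mul]
    refine mul_le_mul ?_ ?_ (abs_nonneg _) ((norm_nonneg _).trans (hM₀ s hs x))
    · rw [← Real.norm_eq_abs]; exact hM₀ s hs x
    · rw [abs_mul, abs_of_pos (by norm_num : (0 : ℝ) < 2 / 5)]
      exact mul_le_mul_of_nonneg_left (hKZ _ (hz.rhoC_sigma_mem hσ hs x)).2 (by norm_num)
  -- event inclusion: off both exceptional events the deterministic core gives `T₁weighted ≥ -η`
  have hsub : {z | Regular σ r τ c η₁ (Φ N) z ∧ T₁weighted σ r τ φ (Φ N) z < -η} ⊆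
      {z | Regular σ r τ c η₁ (Φ N) z ∧
          η * c / ((M + 1) * K) * r < ∫ s in Set.Icc (0 : ℝ) τ, ∫ x : T3,
            ∑ k : Fin 3, ∑ l : Fin 3, |devC r ((Φ N).flow s z) x k l|} ∪
        {z | Regular σ r τ c η₁ (Φ N) z ∧
          ∃ s ∈ Set.Icc (0 : ℝ) τ, ∃ x : T3, ∃ k l : Fin 3,
            K < r * |pD k (fun y => uC r ((Φ N).flow s z) y l) x|} := by
    rintro z ⟨hReg, hT⟩
    rw [T₁weighted_eq_T₁] at hT
    by_contra hcon
    simp only [Set.mem_union, Set.mem_setOf_eq, not_or, not_and, not_lt, not_exists] at hcon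
    obtain ⟨hA, hB⟩ := hcon
    have hA' := hA hReg
    have hB' : ∀ s ∈ Set.Icc (0 : ℝ) τ, ∀ x, ∀ k l : Fin 3,
        r * |pD k (fun y => uC r ((Φ N).flow s z) y l) x| ≤ K := fun s hs x k l => hB hReg s hs x k l
    have hcore := psvK_abs_T₁_le hr hc hτ.le hReg (hM z hReg) hB'
    have hW : 0 ≤ M * K / (c * r) := by positivity
    have h1 := hcore.trans (mul_le_mul_of_nonneg_left hA' hW)
    have h2 : M * K / (c * r) * (η * c / ((M + 1) * K) * r) = η * (M / (M + 1)) := by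
      field_simp
    have h3 : η * (M / (M + 1)) < η := by
      have : M / (M + 1) < 1 := by rw [div_lt_one (by positivity)]; linarith
      nlinarith
    rw [h2] at h1
    have h4 := neg_abs_le (T₁ σ r τ
      (fun s x => φ s x * (2 / 5 * (hsCompressibility (rhoC r ((Φ N).flow s z) x * σ ^ 3) - 1))) (Φ N) z)
    linarith
  calc localGibbsLaw σ a₀ u₀ θ₀ N (Φ N) {z | Regular σ r τ c η₁ (Φ N) z ∧ T₁weighted σ r τ φ (Φ N) z < -η}
      ≤ localGibbsLaw σ a₀ u₀ θ₀ N (Φ N)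
          ({z | Regular σ r τ c η₁ (Φ N) z ∧
              η * c / ((M + 1) * K) * r < ∫ s in Set.Icc (0 : ℝ) τ, ∫ x : T3,
                ∑ k : Fin 3, ∑ l : Fin 3, |devC r ((Φ N).flow s z) x k l|} ∪
            {z | Regular σ r τ c η₁ (Φ N) z ∧
              ∃ s ∈ Set.Icc (0 : ℝ) τ, ∃ x : T3, ∃ k l : Fin 3,
                K < r * |pD k (fun y => uC r ((Φ N).flow s z) y l) x|}) := measure_mono hsub
    _ ≤ _ := measure_union_le _ _
    _ ≤ ENNReal.ofReal (δ / 2) + ENNReal.ofReal (δ / 2) := add_le_add E1 E2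
    _ = ENNReal.ofReal δ := by rw [← ENNReal.ofReal_add hδ2.le hδ2.le, add_halves]

/-- **P2 from crux-3-type and crux-2/4-type inputs only** (registered `passivityCollisional_of_enskog_isotropy`): an
EvenStressEnskog law for the strain-weighted marks (W), kinetic `L¹`-isotropy at rate `r` and strain tightness at
rate `1/r` imply `stub_passivityCollisional`'s statement verbatim. -/
theorem passivityCollisional_of_enskog_isotropy :
  CollisionalWorkEnskogLaw → (∀ (a₀ θ₀ : T3 → ℝ) (u₀ : T3 → V3), Continuous a₀ → Continuous θ₀ → Continuous u₀ → (∀ x, 0 < a₀ x) → (∀ x, 0 < θ₀ x) → ∃ σ₀ : ℝ, 0 < σ₀ ∧ ∀ σ : ℝ, 0 < σ → σ < σ₀ → ∀ (T : ℝ) (ρ θ : ℝ → T3 → ℝ) (u : ℝ → T3 → V3), IsHardSphereEulerSolution σ T ρ u θ → ∀ Φ : (N : ℕ) → Flow σ N, TendstoHydroFieldsAt (fun N => localGibbsLaw σ a₀ u₀ θ₀ N (Φ N)) Φ ρ u θ 0 → 0 < T → ∀ τ : ℝ, 0 < τ → ∀ c η₁ : ℝ, 0 < c → ∀ η δ : ℝ,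 0 < η → 0 < δ → ∃ r₀ : ℝ, 0 < r₀ ∧ ∀ r : ℝ, 0 < r → r < r₀ → ∃ N₀ : ℕ, ∀ N : ℕ, N₀ ≤ N → localGibbsLaw σ a₀ u₀ θ₀ N (Φ N) {z | Regular σ r τ c η₁ (Φ N) z ∧ η * r < ∫ s in Set.Icc (0 : ℝ) τ, ∫ x : T3, ∑ k : Fin 3, ∑ l : Fin 3, |devC r ((Φ N).flow s z) x k l|} ≤ ENNReal.ofReal δ) → (∀ (a₀ θ₀ : T3 → ℝ) (u₀ : T3 → V3), Continuous a₀ → Continuous θ₀ → Continuous u₀ → (∀ x, 0 < a₀ x) → (∀ x, 0 < θ₀ x) → ∃ σ₀ : ℝ, 0 < σ₀ ∧ ∀ σ : ℝ, 0 < σ → σ < σ₀ → ∀ (T : ℝ) (ρ θ : ℝ → T3 → ℝ) (u : ℝ → T3 → V3), IsHardSphereEulerSolution σ T ρ u θ → ∀ Φ : (N : ℕ) → Flow σ N, TendstoHydroFieldsAt (fun N => localGibbsLaw σ a₀ u₀ θ₀ N (Φ N)) Φ ρ u θ 0 → 0 < T → ∀ τ : ℝ, 0 < τ → ∀ c η₁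 : ℝ, 0 < c → ∀ δ : ℝ, 0 < δ → ∃ K : ℝ, 0 < K ∧ ∃ r₀ : ℝ, 0 < r₀ ∧ ∀ r : ℝ, 0 < r → r < r₀ → ∃ N₀ : ℕ, ∀ N : ℕ, N₀ ≤ N → localGibbsLaw σ a₀ u₀ θ₀ N (Φ N) {z | Regular σ r τ c η₁ (Φ N) z ∧ ∃ s ∈ Set.Icc (0 : ℝ) τ, ∃ x : T3, ∃ k l : Fin 3, K < r * |pD k (fun y => uC r ((Φ N).flow s z) y l) x|} ≤ ENNReal.ofReal δ) → ∀ (η₀ : ℝ) (F : ℝ → ℝ), EosBand η₀ F → ∀ η₁ : ℝ, 0 < η₁ → η₁ < η₀ → ∀ (a₀ θ₀ : T3 → ℝ) (u₀ : T3 → V3), Continuous a₀ → Continuous θ₀ → Continuous u₀ → (∀ x, 0 < a₀ x) → (∀ x, 0 < θ₀ x) → ∃ σ₀ : ℝ, 0 < σ₀ ∧ ∀ σ : ℝ, 0 < σ → σ < σ₀ → ∀ (T : ℝ) (ρ θ : ℝ → T3 → ℝ) (u : ℝ → T3 → V3), IsHardSphereEulerSolution σ T ρ u θ → ∀ Φ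 : (N : ℕ) → Flow σ N, TendstoHydroFieldsAt (fun N => localGibbsLaw σ a₀ u₀ θ₀ N (Φ N)) Φ ρ u θ 0 → 0 < T → ∀ τ : ℝ, 0 < τ → ∀ φ : ℝ → T3 → ℝ, Literature.Analysis.FunctionSpaces.Torus.IsSmoothSpaceTimeOn Set.univ φ → (∀ s x, 0 ≤ φ s x) → (∃ τ' : ℝ, τ' < τ ∧ ∀ s, τ' ≤ s → ∀ x, φ s x = 0) → ∀ c : ℝ, 0 < c → ∀ η δ : ℝ, 0 < η → 0 < δ → ∃ r₀ : ℝ, 0 < r₀ ∧ ∀ r : ℝ, 0 < r → r < r₀ → ∃ N₀ : ℕ, ∀ N : ℕ, N₀ ≤ N → localGibbsLaw σ a₀ u₀ θ₀ N (Φ N) {z | Regular σ r τ c η₁ (Φ N) z ∧ T₂ σ r τ φ (Φ N) z < -η} ≤ ENNReal.ofReal δ :=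
  fun hW hIso hStr => passivityCollisional_of_enskog hW (weightedKineticPassivity_of_isotropy hIso hStr)
    collisionalWorkIntegrable_holds

end Summit.AtomisticToContinuum.HydrodynamicLimit.Theorems.LocalSecondLawLedger

end
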